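import Summits.Ventures.GridStability.Bench.WSCC9SP9SlabRoa
import Summits.Ventures.GridStability.Lyapunov.WSCC9SP9SlabBData
import Summits.Ventures.GridStability.Models.StructurePreservingSlabRankOne

/-!
# GridStability/Bench/WSCC9SP9SlabBRoa — SP-lane canary «G2.b-SP9-SLAB», SECOND KERNEL LINEAGE (toolchain B,
# sos-2's LEVEL-optimised slab certificate) with the RANK-ONE level: the region-size rider

Cell `gridfusion` (LADDER-GRIDFUSION), SP–Lur'e lane; lead RULINGS R-SP9-ROW AMENDMENT (05:42:24Z) and
R-SP9-LEVEL (06:00:29Z: «a REGION-SIZE RIDER on the same cell … sentence upgrade "inner ball ≈ 10°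
(rank-one level)" beside "0.5° (ε-level)", both CERTIFIED, never merged»); seat gridfusion-model-2 (g6).
**CANARY, NOT OF RECORD.** SAME object and class as `Bench/WSCC9SP9SlabRoa.lean` (p504776: `D`, `AQ`,
`BQ`, `CQ`, `A_eq`, `B_eq`, `C_eq`, `e1`, `e2` are REUSED from there): `WSCC9SP.relLurie D`, D = MV-SPD
transplant machines + buses `1/10`, slab `u = 1/4`, `γ_lo = 97/200`, `a = 7/10`, `b = 1`, `η = 1/1000`.
DIFFERENT certificate: sos-2's (`cert/B/slab/WSCC9SP9-slab-u1o4-a7o10-rk-B.json`, image-form SDP,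
level-optimised), re-checked exactly and Gram-certified by model-2 (kit j270956; data file
`Lyapunov/WSCC9SP9SlabBData.lean`). WHAT IS PROVED: `certB : SlabCertificate (WSCC9SP.relLurie D)`
(its `P_symm`, `P_ge`, `lmi` fields carry the kernel identities as local facts: `−fromBlocks(L11QB, L12QB,
L12QBᵀ, L22QB) = M2Bq` reindexed, ONE `decide` over `ℚ`), and **`sp9B_slab_roa_rankOne`** =
`WSCC9SP.slab_roa_of_rankOne` (p506402) with sos-2's eight exact `s_e` (PSD facts `s_e·P − C_eᵀC_e ⪰ 0`
from integer Gram certificates) and the rank-one level `c_rk = 34123397/1073741824 ≈ 3.18·10⁻²`: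
**for MODEL M′_D: from every phase point whose 8 listed line-angle deviations satisfy `|σ_e − σ*_e| ≤ 97/200`
and whose relative state has `V_B(relState y) ≤ c_rk`, a solution exists and EVERY solution keeps
`|σ_e(t) − σ*_e| < 2·atan(1/4)` and `V_B ≤ c_rk` for all `t ≥ 0`, every bus-angle difference tends to the
equilibrium's, every machine frequency deviation tends to `0`.** THREE COLUMNS. CERTIFIED: that sentence
for MODEL M′_D, CLASS = slab `u = 1/4`, `γ_lo = 97/200`, RANK-ONE level `c_rk`. MODELLED: as the A file
(«MV-3 + lossless + MV-RD(0.046 @ slack G1) + D⟨declared: MV-SPD transplant machines, buses 1/10 synthetic⟩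
+ V-frozen(V1) + ω_R printed + ref bus 9; canary NOT of record»). VALIDATED: sos-2's SDP; the region datum —
inner relative-state ball ≈ 7.8° by model-2's crude bound `c_rk/λ_max(P + 2CᵀΛC)`, ≈ 10.2° by sos-2's
sharper `t_W` bound; vs ≈ 0.5–0.8° at the ε-level — ×12 in radius at the same certificate. Nothing here
says the WSCC system or any grid is stable.
-/

noncomputable section

open Set Filter Topology Real Matrix
open Literature.MathematicalPhysics.PowerSystems
open Literature.MathematicalPhysics.PowerSystems.LyapunovFunctionFamily
open Literature.Computation.Certificates
open Summit.Ventures.GridStability.Models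
open Summit.Ventures.GridStability.Models.StructurePreserving
open Summit.Ventures.GridStability.Models.WSCC9SP
open Summit.Ventures.GridStability.Lyapunov.WSCC9SP9Slab (aQ)
open Summit.Ventures.GridStability.Lyapunov.WSCC9SP9SlabB
open Summit.Ventures.GridStability.Bench.WSCC9SP9Slab (D hD e1 e2 AQ BQ CQ A_eq B_eq C_eq)

namespace Summit.Ventures.GridStability.Bench.WSCC9SP9SlabB

/-! ### Cast plumbing -/

/-- `(M·N) ↦ ℝ` = product of the casts (plumbing). -/
private theorem map_mul' {m n o : Type*} [Fintype n] (M : Matrix m n ℚ) (N : Matrix n o ℚ) :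
    (M * N).map (Rat.cast : ℚ → ℝ) = M.map (Rat.cast : ℚ → ℝ) * N.map (Rat.cast : ℚ → ℝ) :=
  Matrix.map_mul (f := Rat.castHom ℝ)
/-- `(M+N) ↦ ℝ` (plumbing). -/
private theorem map_add' {m n : Type*} (M N : Matrix m n ℚ) :
    (M + N).map (Rat.cast : ℚ → ℝ) = M.map (Rat.cast : ℚ → ℝ) + N.map (Rat.cast : ℚ → ℝ) := by
  ext i j; simp
/-- `(M−N) ↦ ℝ` (plumbing). -/
private theorem map_sub' {m n : Type*} (M N : Matrix m n ℚ) :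
    (M - N).map (Rat.cast : ℚ → ℝ) = M.map (Rat.cast : ℚ → ℝ) - N.map (Rat.cast : ℚ → ℝ) := by
  ext i j; simp
/-- `(−M) ↦ ℝ` (plumbing). -/
private theorem map_neg' {m n : Type*} (M : Matrix m n ℚ) :
    (-M).map (Rat.cast : ℚ → ℝ) = -M.map (Rat.cast : ℚ → ℝ) := by
  ext i j; simp
/-- transpose commutes with the cast (plumbing). -/
private theorem map_transpose' {m n : Type*} (M : Matrix m n ℚ) :
    Mᵀ.map (Rat.cast : ℚ → ℝ) = (M.map (Rat.cast : ℚ → ℝ))ᵀ := rfl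
/-- `diag(d) ↦ ℝ` (plumbing). -/
private theorem map_diagonal' {n : Type*} [DecidableEq n] (d : n → ℚ) :
    (Matrix.diagonal d).map (Rat.cast : ℚ → ℝ) = Matrix.diagonal (fun i => (d i : ℝ)) :=
  Matrix.diagonal_map Rat.cast_zero
/-- `(q·1) ↦ ℝ` (plumbing). -/
private theorem map_smul_one' {n : Type*} [DecidableEq n] (q : ℚ) :
    (q • (1 : Matrix n n ℚ)).map (Rat.cast : ℚ → ℝ) = (q : ℝ) • (1 : Matrix n n ℝ) := by
  ext i j
  by_cases h : i = j
  · subst h; simp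
  · simp [h]

/-! ### sos-2's certificate over `ℚ` (state-indexed) and over `ℝ` -/

/-- `P_B` over `ℚ`, reindexed to the state type. -/
def PQB : Matrix (Fin 8 ⊕ Fin 3) (Fin 8 ⊕ Fin 3) ℚ := PBq.submatrix e1 e1
/-- `τ_e·a·b`. -/
def tabBQ : Fin 8 → ℚ := fun e => tauBQ e * (aQ * 1)
/-- `τ_e·(a + b)/2`. -/
def tab2BQ : Fin 8 → ℚ := fun e => tauBQ e * (aQ + 1) / 2
/-- State block over `ℚ`. -/
def L11QB : Matrix (Fin 8 ⊕ Fin 3) (Fin 8 ⊕ Fin 3) ℚ :=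
  AQᵀ * PQB + PQB * AQ + etaBQ • (1 : Matrix (Fin 8 ⊕ Fin 3) (Fin 8 ⊕ Fin 3) ℚ)
    - CQᵀ * Matrix.diagonal tabBQ * CQ
/-- Cross block over `ℚ`. -/
def L12QB : Matrix (Fin 8 ⊕ Fin 3) (Fin 8) ℚ :=
  -(PQB * BQ) + (CQ * AQ)ᵀ * Matrix.diagonal lamBQ + CQᵀ * Matrix.diagonal tab2BQ
/-- Channel block over `ℚ`. -/
def L22QB : Matrix (Fin 8) (Fin 8) ℚ :=
  -(Matrix.diagonal lamBQ * (CQ * BQ)) - (Matrix.diagonal lamBQ * (CQ * BQ))ᵀ - Matrix.diagonal tauBQ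

/-- `P_B` (real). -/
def PB : Matrix (Fin 8 ⊕ Fin 3) (Fin 8 ⊕ Fin 3) ℝ := PQB.map (Rat.cast : ℚ → ℝ)
/-- `τ_B` (real). -/
def τB : Fin 8 → ℝ := fun e => (tauBQ e : ℝ)
/-- `λ_B` (real). -/
def lamB : Fin 8 → ℝ := fun e => (lamBQ e : ℝ)
/-- `a = 7/10`. -/
def aB : Fin 8 → ℝ := fun _ => (aQ : ℝ)
/-- `b = 1`. -/
def bB : Fin 8 → ℝ := fun _ => 1
/-- rank-one constants `s_e` (real). -/
def sB : Fin 8 → ℝ := fun e => (sBQ e : ℝ)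

/-! ### The certificate (all kernel identities carried as local facts) -/

set_option maxHeartbeats 800000 in
/-- **sos-2's LEVEL-optimised SLAB CERTIFICATE** for `WSCC9SP.relLurie D` as lit-6's `SlabCertificate`
(`ε = 30473/2²⁴`, `η = 1/1000`, `a = 7/10`, `b = 1`); matrix facts from the kernel-decided integer Gram
certificates of `WSCC9SP9SlabBData`; the identity `−𝓛 = M2Bq` (reindexed) is decided over `ℚ` inside.
CANARY, NOT OF RECORD. [cite: Pai1981, §2.16 Theorem [18] eqs. (2.63)–(2.64); VuTuritsyn2017, §4.2 Lemma 1] -/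
def certB : SlabCertificate (WSCC9SP.relLurie D) where
  P := PB
  ε := (epsBQ : ℝ)
  η := (etaBQ : ℝ)
  τ := τB
  lam := lamB
  a := aB
  b := bB
  P_symm := by
    have ht : PQBᵀ = PQB := by decide +kernel
    show (PQB.map (Rat.cast : ℚ → ℝ))ᵀ = PQB.map (Rat.cast : ℚ → ℝ)
    rw [← map_transpose', ht]
  ε_pos := by exact_mod_cast epsB_facts.2.1
  η_pos := by exact_mod_cast epsB_facts.2.2
  P_ge := by
    have hsub : PB - (epsBQ : ℝ) • (1 : Matrix (Fin 8 ⊕ Fin 3) (Fin 8 ⊕ Fin 3) ℝ)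
        = ((PBq - epsBQ • (1 : Matrix (Fin 11) (Fin 11) ℚ)).map (Rat.cast : ℚ → ℝ)).submatrix e1 e1 := by
      ext i j
      by_cases h : i = j
      · subst h; simp [PB, PQB]
      · have h' : e1 i ≠ e1 j := fun he => h (e1.injective he)
        simp [PB, PQB, h, h']
    rw [hsub]
    exact (Matrix.posSemidef_submatrix_equiv e1).2 posSemidefB.1
  τ_nonneg := fun e => by unfold τB; exact_mod_cast (multB_nonneg e).1
  lam_nonneg := fun e => by unfold lamB; exact_mod_cast (multB_nonneg e).2
  a_nonneg_of_lam_pos := fun e _ => by unfold aB aQ; norm_num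
  lmi := by
    have hd : Matrix.diagonal (fun k => τB k * (aB k * bB k))
        = (Matrix.diagonal tabBQ).map (Rat.cast : ℚ → ℝ) := by
      rw [map_diagonal']; congr 1; funext k; simp [τB, aB, bB, tabBQ]
    have hd1 : Matrix.diagonal lamB = (Matrix.diagonal lamBQ).map (Rat.cast : ℚ → ℝ) := by
      rw [map_diagonal']; rfl
    have hd2 : Matrix.diagonal (fun k => τB k * (aB k + bB k) / 2)
        = (Matrix.diagonal tab2BQ).map (Rat.cast : ℚ → ℝ) := by
      rw [map_diagonal']; congr 1; funext k; simp [τB, aB, bB, tab2BQ]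
    have hd3 : Matrix.diagonal τB = (Matrix.diagonal tauBQ).map (Rat.cast : ℚ → ℝ) := by
      rw [map_diagonal']; rfl
    have h11 : slabL11 (WSCC9SP.relLurie D) PB (etaBQ : ℝ) τB aB bB = L11QB.map (Rat.cast : ℚ → ℝ) := by
      rw [slabL11, A_eq, C_eq, hd, PB, L11QB]
      simp only [map_sub', map_add', map_mul', map_transpose', map_smul_one']
    have h12 : slabL12 (WSCC9SP.relLurie D) PB lamB τB aB bB = L12QB.map (Rat.cast : ℚ → ℝ) := by
      rw [slabL12, A_eq, B_eq, C_eq, hd1, hd2, PB, L12QB]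
      simp only [map_add', map_neg', map_mul', map_transpose']
    have h22 : slabL22 (WSCC9SP.relLurie D) lamB τB = L22QB.map (Rat.cast : ℚ → ℝ) := by
      rw [slabL22, B_eq, C_eq, hd1, hd3, L22QB]
      simp only [map_sub', map_neg', map_mul', map_transpose']
    have hQ : -(Matrix.fromBlocks L11QB L12QB L12QBᵀ L22QB) = M2Bq.submatrix e2 e2 := by
      decide +kernel
    have hneg : -(slabMatrix (WSCC9SP.relLurie D) PB (etaBQ : ℝ) lamB τB aB bB)
        = (M2Bq.map (Rat.cast : ℚ → ℝ)).submatrix e2 e2 := by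
      rw [slabMatrix, h11, h12, h22, ← map_transpose', ← Matrix.fromBlocks_map, ← map_neg', hQ]
      rfl
    rw [hneg]
    exact (Matrix.posSemidef_submatrix_equiv e2).2 posSemidefB.2

/-! ### The rank-one sentence -/

set_option maxHeartbeats 400000 in
/-- **«G2.b-SP9-SLAB», SECOND LINEAGE, RANK-ONE LEVEL (CANARY, NOT OF RECORD).** For every phase point
`y = (δ, ω)` of MODEL M′_D = `(WSCC9SP.params D).phaseField` whose 8 listed line-angle deviations satisfy
`|σ_e − σ*_e| ≤ 97/200` and whose relative state has `V_B(relState y) ≤ c_rk = 34123397/1073741824`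
(`V_B = xᵀP_Bx + 2Σ λ_e∫F_e` of `certB`): a solution from `y` exists and EVERY solution keeps
`|σ_e(t) − σ*_e| < 2·atan(1/4)` and `V_B ≤ c_rk` for all `t ≥ 0`, every bus-angle difference tends to the
equilibrium's, every machine frequency deviation tends to `0`. The level is the RANK-ONE level: sos-2's
eight exact `s_e` with the kernel facts `s_e·P_B − C_eᵀC_e ⪰ 0` and `c_rk·s_e ≤ (97/200)²`. CERTIFIED for
MODEL M′_D; CLASS slab `u = 1/4`, `γ_lo = 97/200`, level `c_rk`; MODELLED as the A file («… canary NOT of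
record»); VALIDATED: sos-2's SDP and the region datum (inner ball ≈ 7.8°–10.2° by the two bounds quoted in
the header, vs ≈ 0.5–0.8° at the ε-level). [cite: Pai1981, §2.16 Theorem [18] and §4.6–§4.7; VuTuritsyn2017, §4.3 Theorem 1 with eq. (V_min)] -/
theorem sp9B_slab_roa_rankOne {y : (Fin 9 → ℝ) × (Fin 9 → ℝ)}
    (hy : ∀ e, |(y.1 (srcV e) - y.1 (tgtV e)) - (δ₀ (srcV e) - δ₀ (tgtV e))| ≤ (97 : ℝ) / 200)
    (hyc : certB.V (relState ref gnode δ₀ y) ≤ (34123397 : ℝ) / 1073741824) :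
    (∃ X : ℝ → (Fin 9 → ℝ) × (Fin 9 → ℝ), X 0 = y ∧
        ∀ T : ℝ, ∀ t ∈ Icc 0 T, HasDerivWithinAt X ((WSCC9SP.params D).phaseField (X t)) (Icc 0 T) t) ∧
      ∀ X : ℝ → (Fin 9 → ℝ) × (Fin 9 → ℝ), X 0 = y →
        (∀ T : ℝ, ∀ t ∈ Icc 0 T, HasDerivWithinAt X ((WSCC9SP.params D).phaseField (X t)) (Icc 0 T) t) →
        (∀ t, 0 ≤ t →
            (∀ e, |((X t).1 (srcV e) - (X t).1 (tgtV e)) - (δ₀ (srcV e) - δ₀ (tgtV e))|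
              < 2 * Real.arctan ((1 / 4 : ℚ) : ℝ)) ∧
            certB.V (relState ref gnode δ₀ (X t)) ≤ (34123397 : ℝ) / 1073741824) ∧
          (∀ v w, Tendsto (fun t => (X t).1 v - (X t).1 w) atTop (𝓝 (δ₀ v - δ₀ w))) ∧
          ∀ v ∈ genS, Tendsto (fun t => (X t).2 v) atTop (𝓝 0) := by
  -- the C rows of the relative object are the casts of the flattened rows `CrowQ`
  have hC : ∀ e a, CQ e a = CrowQ e (e1 a) := by decide +kernel
  have hs : ∀ e, (sB e • certB.P
      - Matrix.vecMulVec ((WSCC9SP.relLurie D).C e) ((WSCC9SP.relLurie D).C e)).PosSemidef := by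
    intro e
    have hmat : sB e • certB.P - Matrix.vecMulVec ((WSCC9SP.relLurie D).C e) ((WSCC9SP.relLurie D).C e)
        = ((sBQ e • PBq - Matrix.vecMulVec (CrowQ e) (CrowQ e)).map (Rat.cast : ℚ → ℝ)).submatrix
            e1 e1 := by
      ext a b
      rw [C_eq]
      simp [certB, PB, PQB, sB, Matrix.vecMulVec, hC]
    rw [hmat]
    exact (Matrix.posSemidef_submatrix_equiv e1).2 (posSemidefB_rankOne e)
  have ha : ∀ e, certB.a e ≤ (slabSlope (1 / 4) : ℝ) := fun e => by
    show ((aQ : ℚ) : ℝ) ≤ ((slabSlope (1 / 4) : ℚ) : ℝ)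
    exact_mod_cast (show aQ ≤ slabSlope (1 / 4) by norm_num [aQ, slabSlope, tauV1])
  have hb1 : ∀ e, (1 : ℝ) ≤ certB.b e := fun _ => le_refl _
  have hs0 : ∀ e, 0 < sB e := fun e => by unfold sB; exact_mod_cast (rankOneB_test e).1
  have hc : ∀ e, ((cRkBQ : ℚ) : ℝ) * sB e ≤ (((97 / 200 : ℚ)) : ℝ) ^ 2 := fun e => by
    unfold sB; exact_mod_cast (rankOneB_test e).2
  have hlev : ((cRkBQ : ℚ) : ℝ) = (34123397 : ℝ) / 1073741824 := by norm_num [cRkBQ]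
  have hglo : (((97 / 200 : ℚ)) : ℝ) = (97 : ℝ) / 200 := by norm_num
  have hy' : ∀ e, |(y.1 (srcV e) - y.1 (tgtV e)) - (δ₀ (srcV e) - δ₀ (tgtV e))|
      ≤ (((97 / 200 : ℚ)) : ℝ) := fun e => by rw [hglo]; exact hy e
  have hyc' : certB.V (relState ref gnode δ₀ y) ≤ ((cRkBQ : ℚ) : ℝ) := by rw [hlev]; exact hyc
  have h := WSCC9SP.slab_roa_of_rankOne hD certB (u := 1 / 4) (γlo := 97 / 200) (by norm_num)
    (by norm_num) (by norm_num) (by norm_num) ha hb1 hs0 hs hc hy' hyc'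
  rw [hlev] at h
  exact h

end Summit.Ventures.GridStability.Bench.WSCC9SP9SlabB

end
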